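import Summits.BirchSwinnertonDyer.BirchSwinnertonDyer.Theorems.PrintCf2SplitBadTwoDyadicTorsionTable
import Summits.BirchSwinnertonDyer.BirchSwinnertonDyer.Theorems.PrintCf2SplitBadTwoLocalPointsPadicTransport
import HarnessLib

/-!
# Crux `PrintCf2.SplitBadTwoRankOneOfFacts` (stmt-BirchSwinnertonDyer-20368), road α v10.3, S3c factor (F3), piece (LF.1):
# THE LOCAL TORSION COUNT AT `v` — `#E(K_v)[2^N] = #E^{(d)}(ℚ₂)[2^∞] = 2^{2 + [d ≡ 3 (8)]}` for `N ≥ 3`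

Cell `bsd-print-cf2`, width seat `bsd-line-cf2-p1-w2` g11; `--supports stmt-BirchSwinnertonDyer-20368` (helper, Theses-free).
HONEST FRAMING: nothing here closes a crux or a stub; BSD is not proved by any of this; no summit statement is proved by this seat.
No definition, no named fact, no `sorry`, no kit. beyond-print theorem: no (bookkeeping).

WHY. -w5 g3's `hF3_of_levelCounts` (p678471) reduces (F3) to `hcounts` (the 2-adic valuation of a level-`N` Selmer index), and -w4 g9's
master identity (p678152 `relIndex_selmerGroup_update_top_mul_eq_of_levelProj`) reads
`relIndex · #loc_v((𝓕*).sel) · #(N^E_v ⊓ range H¹(ẽ_N|K_v)) = #E(K_v)[2^N] · #(𝓞_v ⧸ 2^N)` with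
`#E(K_v)[2^N] := Nat.card (nsmulAddMonoidHom (2^N) : ((W_K).baseChange K_v).Point →+ _).ker`. THIS FILE supplies that factor (memo/STATUS
(F3) DECOMPOSITION 23:4xZ, piece (LF.1)):
* `exists_pointEquiv_of_surjective` — a surjective `φ : ℚ_p →+* E` (`E` a field over `ℚ`... any field) gives an additive isomorphism
  `W(ℚ_p) ≃+ (W_K ⊗ E)(E)` of point groups for `W/ℚ` and any number field `K` with `Algebra K E` (coordinates pulled back along `φ`,
  curve identified by `map_map`);
* `natCard_ker_nsmul_eq_of_natCard_primaryComponent` — `#ker(p^N •) = #A[p^∞]` once `#A[p^∞] ∣ p^N`;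
* **`natCard_ker_nsmul_baseChange_adicCompletion_of_frame`** — on the S3c frame (`d` squarefree, `d ≢ 1 (4)`, `C • W = E^{(d)}`, `K` imaginary
  quadratic, `v ≠ v̄` above 2), for every `N ≥ 3`: **`#((W_K ⊗ K_v)(K_v))[2^N] = 8` if `d ≡ 3 (mod 8)`, `= 4` otherwise** — -w4 g6's dyadic
  torsion count `DyadicTorsion.natCard_primaryComponent_two_of_smul_eq_quadraticTwist` (`W(ℚ₂)[2^∞]`) transported along `K_v ≅ ℚ₂`
  (-w6 g3 `exists_surjective_padic_adicCompletion`).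

References: J. H. Silverman, *AEC* 2nd ed. (2009) VIII §1, VII.6.3 [SilvermanAEC2009]; J.-P. Serre, *A Course in Arithmetic* (1973) II §3.3
[Serre1973]; J. Neukirch, *ANT* (1999) II (8.5) [NeukirchANT1999].
-/

noncomputable section

open scoped Classical

set_option linter.dupNamespace false -- `Summit.BirchSwinnertonDyer.BirchSwinnertonDyer` (summit = problem) is the tree's layout
set_option autoImplicit false

open NumberField IsDedekindDomain Field WeierstrassCurve
open Literature.NumberTheory.EllipticCurves

namespace Summit.BirchSwinnertonDyer.BirchSwinnertonDyer.Theorems.PrintCf2.LocalLineCount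

/-! ## §1. Transport of point groups along `ℚ_p ≅ E` -/

/-- **Point transport along a field isomorphism `ℚ_p ≅ E`.** For `W/ℚ`, a field `K` over `ℚ`, a field `E` with `Algebra K E` and
`CharZero E`, and a SURJECTIVE ring map `φ : ℚ_p →+* E`: the point groups `W(ℚ_p)` and `(W_K ⊗_K E)(E)` are additively isomorphic
(map the coordinates along `φ`; identify `(W_K)_E = W_E` by `map_map`). [cite: SilvermanAEC2009, VIII §1] -/
theorem exists_pointEquiv_of_surjective (W : WeierstrassCurve ℚ) (p : ℕ) [Fact p.Prime] (K : Type) [Field K] [CharZero K]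
    (E : Type) [Field E] [Algebra K E] [CharZero E] (φ : ℚ_[p] →+* E) (hφ : Function.Surjective φ) :
    Nonempty ((W.baseChange ℚ_[p]).toAffine.Point ≃+ ((W.baseChange K).baseChange E).toAffine.Point) := by
  let ψ : ℚ_[p] →ₐ[ℚ] E := φ.toRatAlgHom
  have hψ : ∀ a, ψ a = φ a := fun _ ↦ rfl
  have hcurve : (W.baseChange K).baseChange E = W.baseChange E := by
    rw [WeierstrassCurve.baseChange, WeierstrassCurve.baseChange, WeierstrassCurve.baseChange, WeierstrassCurve.map_map]
    exact congrArg W.map (Subsingleton.elim _ _)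
  let F : (W.baseChange ℚ_[p]).toAffine.Point →+ (W.baseChange E).toAffine.Point := Affine.Point.map (W' := W.toAffine) ψ
  have hFinj : Function.Injective F := Affine.Point.map_injective (W' := W.toAffine) ψ
  have hFsurj : Function.Surjective F := by
    intro R
    rcases R with _ | ⟨a, b, h⟩
    · exact ⟨0, map_zero F⟩
    · obtain ⟨a₀, rfl⟩ := hφ a
      obtain ⟨b₀, rfl⟩ := hφ b
      have h₀ : (W.baseChange ℚ_[p]).toAffine.Nonsingular a₀ b₀ :=
        (Affine.baseChange_nonsingular W (f := ψ) ψ.toRingHom.injective a₀ b₀).mp (by rw [hψ, hψ]; exact h)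
      exact ⟨Affine.Point.some a₀ b₀ h₀, by
        change Affine.Point.map ψ (Affine.Point.some a₀ b₀ h₀) = _
        rw [Affine.Point.map_some]; exact Affine.Point.some_eq_some_of_eq (hψ a₀) (hψ b₀)⟩
  exact ⟨(AddEquiv.ofBijective F ⟨hFinj, hFsurj⟩).trans (Affine.Point.congrEquiv hcurve.symm)⟩

/-! ## §2. `#ker(p^N •) = #A[p^∞]` -/

/-- If the `p`-primary component of `A` is finite of order dividing `p^N`, then it IS the kernel of multiplication by `p^N`, so the two have the
same cardinality. [folklore] -/
theorem natCard_ker_nsmul_eq_of_natCard_primaryComponent {A : Type*} [AddCommGroup A] (p : ℕ) (N : ℕ)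
    [Finite (AddCommGroup.primaryComponent A p)] (hdvd : Nat.card (AddCommGroup.primaryComponent A p) ∣ p ^ N) :
    Nat.card (nsmulAddMonoidHom (p ^ N) : A →+ A).ker = Nat.card (AddCommGroup.primaryComponent A p) := by
  refine Nat.card_congr (Equiv.subtypeEquivRight fun x ↦ ?_)
  rw [AddMonoidHom.mem_ker, nsmulAddMonoidHom_apply, AddCommGroup.mem_primaryComponent]
  constructor
  · exact fun h ↦ ⟨N, h⟩
  · intro hx
    have hmem : x ∈ AddCommGroup.primaryComponent A p := (AddCommGroup.mem_primaryComponent).mpr hx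
    have h1 : Nat.card (AddCommGroup.primaryComponent A p) • (⟨x, hmem⟩ : AddCommGroup.primaryComponent A p) = 0 :=
      card_nsmul_eq_zero'
    obtain ⟨k, hk⟩ := hdvd
    have h2 : p ^ N • (⟨x, hmem⟩ : AddCommGroup.primaryComponent A p) = 0 := by
      rw [hk, mul_comm, mul_nsmul', h1, smul_zero]
    exact congrArg Subtype.val h2

/-! ## §3. The S3c frame: `#E(K_v)[2^N]` -/

/-- **(LF.1) THE LOCAL TORSION COUNT AT `v`.** On the S3c frame (`d` squarefree, `d ≢ 1 (mod 4)`, `C • W = E^{(d)}`, `K` imaginary quadratic,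
`v ≠ v̄` the places above `2`), for every `N ≥ 3`:
**`#ker(2^N • on ((W_K) ⊗ K_v)(K_v)) = 8` if `d ≡ 3 (mod 8)` and `= 4` otherwise** (`= #E^{(d)}(ℚ₂)[2^∞]`, -w4 g6, along `K_v ≅ ℚ₂`).
This is the factor `#E(K_v)[2^N]` of -w4 g9's master identity p678152 for hcounts.
[cite: SilvermanTate2015, §3.5] [cite: Serre1973, Ch. II §3.3 Thm 4] [cite: NeukirchANT1999, Ch. II (8.5)] -/
theorem natCard_ker_nsmul_baseChange_adicCompletion_of_frame {d : ℤ} (hsq : Squarefree d) (hd4 : d % 4 ≠ 1)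
    (W : WeierstrassCurve ℚ) [W.IsElliptic] {C : VariableChange ℚ} (hC : C • W = cm7.quadraticTwist (d : ℚ))
    {K : Type} [Field K] [NumberField K] (hK : IsImaginaryQuadratic K) {v vbar : HeightOneSpectrum (𝓞 K)}
    (hv : ((2 : ℕ) : 𝓞 K) ∈ v.asIdeal) (hvbar : ((2 : ℕ) : 𝓞 K) ∈ vbar.asIdeal) (hne : vbar ≠ v) {N : ℕ} (hN : 3 ≤ N) :
    Nat.card (nsmulAddMonoidHom (2 ^ N) :
        ((W.baseChange K).baseChange (v.adicCompletion K)).toAffine.Point →+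
          ((W.baseChange K).baseChange (v.adicCompletion K)).toAffine.Point).ker =
      if d % 8 = 3 then 8 else 4 := by
  haveI : Fact (Nat.Prime 2) := ⟨Nat.prime_two⟩
  haveI : CharZero (v.adicCompletion K) := charZero_of_injective_algebraMap (algebraMap K _).injective
  obtain ⟨φ, hφ⟩ := RestrictedSelmerPair.exists_surjective_padic_adicCompletion hK.1 hvbar hv hne.symm
  obtain ⟨e⟩ := exists_pointEquiv_of_surjective W 2 K (v.adicCompletion K) φ hφ
  have hQ2 := DyadicTorsion.natCard_primaryComponent_two_of_smul_eq_quadraticTwist hsq hd4 W hC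
  -- transport of the `2`-primary component and of the kernel
  have hprim : Nat.card (AddCommGroup.primaryComponent ((W.baseChange K).baseChange (v.adicCompletion K)).toAffine.Point 2) =
      if d % 8 = 3 then 8 else 4 := by
    rw [← natCard_primaryComponent_congr e 2, hQ2]
  have hpos : 0 < Nat.card (AddCommGroup.primaryComponent ((W.baseChange K).baseChange (v.adicCompletion K)).toAffine.Point 2) := by
    rw [hprim]; split_ifs <;> norm_num
  haveI : Finite (AddCommGroup.primaryComponent ((W.baseChange K).baseChange (v.adicCompletion K)).toAffine.Point 2) :=
    Nat.finite_of_card_ne_zero hpos.ne'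
  have hdvd : Nat.card (AddCommGroup.primaryComponent ((W.baseChange K).baseChange (v.adicCompletion K)).toAffine.Point 2) ∣ 2 ^ N := by
    rw [hprim]
    obtain ⟨k, rfl⟩ := Nat.exists_eq_add_of_le hN
    split_ifs
    · exact ⟨2 ^ k, by rw [pow_add]; norm_num⟩
    · exact ⟨2 * 2 ^ k, by rw [pow_add]; norm_num; ring⟩
  rw [natCard_ker_nsmul_eq_of_natCard_primaryComponent 2 N hdvd, hprim]

end Summit.BirchSwinnertonDyer.BirchSwinnertonDyer.Theorems.PrintCf2.LocalLineCount

end
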